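import Summits.ABC.ABC.Theses.PadicPrimesYuNinety
import Summits.ABC.StewartYu.KappaDoorSlot
import Summits.ABC.ABC.Theorems.PadicPrimesYuNinetyRung
import HarnessLib

/-!
# Cell abc-stewartyu: the socket from Yu 1990's Finset-shaped bound at the ODD primes to the odd
# κ-door's Fin-shaped input `FinBoundAt p 3 L 1 2 1 1`

`Summits/ABC/StewartYu/PrimePadicSocketYuNinety.lean` — cell `abc-stewartyu` (seat p1; theorems
only, no definition, no named fact). For the planner's STAGED rung route `PadicPrimesYuNinetyOddRadOne`
(rung A1.M2⁻, `log c ≪_ε rad^{1+ε}` from Yu 1990 at the odd primes alone, STATUS 2026-08-26T03:27:58Z):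
its support item `OddTransferSpec` says that the two residue-class cruxes `YuNinetyThreeModFour`
(`p ≡ 3 (mod 4)`) and `YuNinetyOneModFour` (`p ≡ 1 (mod 4)`) of route `PadicPrimesYuNinety` — Finset
form, strict, `(c₅ #S)^{#S} · p² · log B · log log max(4, max S) · ∏ log max(4, q)` — give the odd
one-prime bound in the κ-door's `Fin` form with `(κ, σ, τ, τ₁) = (1, 2, 1, 1)`, `K = 3`,
`L = 2 · max(1, |c₅|, |c₅'|)`. This file proves exactly that (`finBound_odd_of_yuNinety`, with the
two crux texts as hypotheses and the item's conclusion verbatim), so the item closes by a one-liner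
when the route is born.

Bookkeeping: `S = image q` (`#S = n` by injectivity), `e'` = `e` transported along `q`,
`B = max 3 (max |eᵢ|)`; `(c n)^n ≤ |c|^n n^n`; `log max(4,q) ≤ 2 log q` (`max(4,q) ≤ q²`);
`log log max(4, max S) ≤ log max(4, max S) ≤ log 4 + log max(3, ∏ qᵢ) ≤ 3 log max(3, ∏ qᵢ)`;
every odd prime is `≡ 1` or `3 (mod 4)`. Everything is [folklore].
-/

noncomputable section

open Finset Real

namespace Summit.ABC.StewartYu

/-- **Socket: Yu 1990 (Finset form) at the two odd residue classes ⇒ the odd `Fin`-form one-prime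
bound with `(κ, σ, τ, τ₁) = (1, 2, 1, 1)`, `K = 3`, `L = 2·max(1, |c₅|, |c₅'|)`** — the text of the
support item `OddTransferSpec` of the staged route `PadicPrimesYuNinetyOddRadOne`, with the crux texts
`YuNinetyThreeModFour` / `YuNinetyOneModFour` as the hypotheses `h3` / `h1`. [folklore] -/
theorem finBound_odd_of_yuNinety
    (h3 : ∃ c₅ : ℝ, ∀ (p : ℕ), p.Prime → p % 4 = 3 → ∀ (S : Finset ℕ), (∀ q ∈ S, q.Prime) → p ∉ S →
      S.Nonempty → ∀ (e : ℕ → ℤ) (B : ℝ), 3 ≤ B → (∀ q ∈ S, (|e q| : ℝ) ≤ B) →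
      ∏ q ∈ S, (q : ℚ) ^ e q ≠ 1 → (padicValRat p (∏ q ∈ S, (q : ℚ) ^ e q - 1) : ℝ) <
        (c₅ * S.card) ^ S.card * (p : ℝ) ^ 2 * Real.log B *
          Real.log (Real.log ((max 4 (S.sup id) : ℕ) : ℝ)) * ∏ q ∈ S, Real.log ((max 4 q : ℕ) : ℝ))
    (h1 : ∃ c₅ : ℝ, ∀ (p : ℕ), p.Prime → p % 4 = 1 → ∀ (S : Finset ℕ), (∀ q ∈ S, q.Prime) → p ∉ S →
      S.Nonempty → ∀ (e : ℕ → ℤ) (B : ℝ), 3 ≤ B → (∀ q ∈ S, (|e q| : ℝ) ≤ B) →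
      ∏ q ∈ S, (q : ℚ) ^ e q ≠ 1 → (padicValRat p (∏ q ∈ S, (q : ℚ) ^ e q - 1) : ℝ) <
        (c₅ * S.card) ^ S.card * (p : ℝ) ^ 2 * Real.log B *
          Real.log (Real.log ((max 4 (S.sup id) : ℕ) : ℝ)) * ∏ q ∈ S, Real.log ((max 4 q : ℕ) : ℝ)) :
    ∃ (K L : ℝ), 0 ≤ K ∧ 1 ≤ L ∧ ∀ p, p.Prime → p ≠ 2 →
      (∀ (n : ℕ) (q : Fin n → ℕ) (e : Fin n → ℤ), (∀ i, (q i).Prime) → Function.Injective q →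
        (∀ i, q i ≠ p) → e ≠ 0 → ∏ i, ((q i : ℚ)) ^ e i ≠ 1 →
        (padicValRat p (∏ i, ((q i : ℚ)) ^ e i - 1) : ℝ) ≤
          K * L ^ n * (n : ℝ) ^ ((1 : ℝ) * n) * (p : ℝ) ^ (2 : ℝ) * (∏ i, Real.log (q i)) *
            Real.log (max 3 ((Finset.univ.sup fun i => (e i).natAbs : ℕ) : ℝ)) ^ (1 : ℕ) *
            Real.log (max 3 (∏ i, ((q i : ℕ) : ℝ))) ^ (1 : ℕ)) := by
  classical
  obtain ⟨c₃, hc₃⟩ := h3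
  obtain ⟨c₁, hc₁⟩ := h1
  set C : ℝ := max |c₃| |c₁| with hC
  have hC0 : 0 ≤ C := (abs_nonneg c₃).trans (le_max_left _ _)
  set L : ℝ := 2 * max 1 C with hL
  have hL1 : 1 ≤ L := by
    have : (1 : ℝ) ≤ max 1 C := le_max_left _ _
    rw [hL]; linarith
  have hLC : 2 * C ≤ L := by rw [hL]; linarith [le_max_right 1 C]
  refine ⟨3, L, by norm_num, hL1, ?_⟩
  intro p hp hp2 n q e hq hinj hqp he hne1
  -- `n ≥ 1`
  have hn : 1 ≤ n := by
    rcases Nat.eq_zero_or_pos n with h0 | h0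
    · subst h0; exact absurd (funext fun i => Fin.elim0 i) he
    · exact h0
  have hn0 : (0 : ℝ) < n := by exact_mod_cast hn
  haveI : Nonempty (Fin n) := ⟨⟨0, hn⟩⟩
  -- the finite set and the transported exponents
  set S : Finset ℕ := Finset.univ.image q with hS
  have hcard : S.card = n := by
    rw [hS, Finset.card_image_of_injective _ hinj, Finset.card_univ, Fintype.card_fin]
  have hSq : ∀ x ∈ S, ∃ i, q i = x := fun x hx => by
    obtain ⟨i, -, hi⟩ := Finset.mem_image.mp hx; exact ⟨i, hi⟩
  have hqS : ∀ i, q i ∈ S := fun i => Finset.mem_image.mpr ⟨i, Finset.mem_univ i, rfl⟩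
  have hSP : ∀ x ∈ S, x.Prime := fun x hx => by
    obtain ⟨i, rfl⟩ := hSq x hx; exact hq i
  have hpS : p ∉ S := fun h => by obtain ⟨i, hi⟩ := hSq p h; exact hqp i hi
  have hSne : S.Nonempty := ⟨q ⟨0, hn⟩, hqS _⟩
  set e' : ℕ → ℤ := fun x => if h : ∃ i, q i = x then e (Classical.choose h) else 0 with he'
  have he'q : ∀ i, e' (q i) = e i := by
    intro i
    have h : ∃ j, q j = q i := ⟨i, rfl⟩
    simp only [he', dif_pos h]
    congr 1
    exact hinj (Classical.choose_spec h)
  -- re-indexing of products over `S = image q`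
  have hreidx : ∀ {M : Type} [CommMonoid M] (f : ℕ → M), ∏ x ∈ S, f x = ∏ i, f (q i) := by
    intro M _ f
    rw [hS, Finset.prod_image fun i _ j _ h => hinj h]
  have hprodQ : ∏ x ∈ S, (x : ℚ) ^ e' x = ∏ i, ((q i : ℚ)) ^ e i := by
    rw [hreidx]; exact Finset.prod_congr rfl fun i _ => by rw [he'q]
  have hne1' : ∏ x ∈ S, (x : ℚ) ^ e' x ≠ 1 := by rw [hprodQ]; exact hne1
  -- the exponent bound `B = max 3 (max |eᵢ|)`
  set Bn : ℕ := Finset.univ.sup fun i => (e i).natAbs with hBn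
  set B : ℝ := ((max 3 Bn : ℕ) : ℝ) with hB
  have hB3 : (3 : ℝ) ≤ B := by rw [hB]; exact_mod_cast le_max_left 3 Bn
  have hBcast : B = max 3 (Bn : ℝ) := by rw [hB]; push_cast; rfl
  have heB : ∀ x ∈ S, (|e' x| : ℝ) ≤ B := by
    intro x hx
    obtain ⟨i, rfl⟩ := hSq x hx
    rw [he'q, hB]
    have h1 : (e i).natAbs ≤ Bn := Finset.le_sup (f := fun i => (e i).natAbs) (Finset.mem_univ i)
    have h3 : (|(e i : ℝ)|) = (((e i).natAbs : ℕ) : ℝ) := by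
      rw [Nat.cast_natAbs, Int.cast_abs]
    rw [h3]; exact_mod_cast h1.trans (le_max_right 3 Bn)
  -- Yu 1990 at `p`, by residue class
  have hp4 : p % 4 = 3 ∨ p % 4 = 1 := by
    have := Nat.odd_iff.mp (hp.odd_of_ne_two hp2); omega
  have key : ∃ c : ℝ, |c| ≤ C ∧ (padicValRat p (∏ x ∈ S, (x : ℚ) ^ e' x - 1) : ℝ) <
      (c * S.card) ^ S.card * (p : ℝ) ^ 2 * Real.log B *
        Real.log (Real.log ((max 4 (S.sup id) : ℕ) : ℝ)) * ∏ x ∈ S, Real.log ((max 4 x : ℕ) : ℝ) := by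
    rcases hp4 with h | h
    · exact ⟨c₃, le_max_left _ _, hc₃ p hp h S hSP hpS hSne e' B hB3 heB hne1'⟩
    · exact ⟨c₁, le_max_right _ _, hc₁ p hp h S hSP hpS hSne e' B hB3 heB hne1'⟩
  obtain ⟨c, hcC, hlt⟩ := key
  rw [hprodQ, hcard] at hlt
  -- the factors
  set X : ℝ := Real.log (max 3 (∏ i, ((q i : ℕ) : ℝ))) with hX
  set PL : ℝ := ∏ i, Real.log (q i) with hPL
  have hq2 : ∀ i, (2 : ℝ) ≤ q i := fun i => by exact_mod_cast (hq i).two_le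
  have hPL0 : 0 < PL := Finset.prod_pos fun i _ => Real.log_pos (by linarith [hq2 i])
  have hX1 : 1 ≤ X := by
    have h3 : (1 : ℝ) ≤ Real.log 3 := by
      rw [Real.le_log_iff_exp_le (by norm_num)]
      exact Real.exp_one_lt_d9.le.trans (by norm_num)
    exact h3.trans (Real.log_le_log (by norm_num) (le_max_left _ _))
  have hlogB0 : 0 < Real.log B := Real.log_pos (by linarith)
  -- `(c n)^n ≤ C^n n^n`
  have hcn : (c * n) ^ n ≤ C ^ n * (n : ℝ) ^ n := by
    calc (c * (n : ℝ)) ^ n ≤ |(c * (n : ℝ)) ^ n| := le_abs_self _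
      _ = |c| ^ n * (n : ℝ) ^ n := by rw [abs_pow, abs_mul, abs_of_nonneg hn0.le, mul_pow]
      _ ≤ C ^ n * (n : ℝ) ^ n :=
          mul_le_mul_of_nonneg_right (pow_le_pow_left₀ (abs_nonneg c) hcC n) (by positivity)
  -- `∏ log max(4, qᵢ) ≤ 2^n ∏ log qᵢ`
  have hPLmax : ∏ x ∈ S, Real.log ((max 4 x : ℕ) : ℝ) ≤ 2 ^ n * PL := by
    rw [hreidx, hPL]
    have hterm : ∀ i, Real.log ((max 4 (q i) : ℕ) : ℝ) ≤ 2 * Real.log (q i) := by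
      intro i
      have hle : ((max 4 (q i) : ℕ) : ℝ) ≤ (q i : ℝ) ^ 2 := by
        have h4 : (4 : ℝ) ≤ (q i : ℝ) ^ 2 := by nlinarith [hq2 i]
        have hq' : (q i : ℝ) ≤ (q i : ℝ) ^ 2 := by nlinarith [hq2 i]
        rcases le_total 4 (q i) with h | h
        · rw [max_eq_right h]; exact hq'
        · rw [max_eq_left h]; exact_mod_cast h4
      have hpos : (0 : ℝ) < ((max 4 (q i) : ℕ) : ℝ) := by
        exact_mod_cast lt_of_lt_of_le (by norm_num) (le_max_left 4 (q i))
      calc Real.log ((max 4 (q i) : ℕ) : ℝ) ≤ Real.log ((q i : ℝ) ^ 2) := Real.log_le_log hpos hle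
        _ = 2 * Real.log (q i) := by rw [Real.log_pow]; norm_num
    have h0 : ∀ i, 0 ≤ Real.log ((max 4 (q i) : ℕ) : ℝ) := fun i =>
      Real.log_nonneg (by exact_mod_cast le_trans (by norm_num) (le_max_left 4 (q i)))
    calc ∏ i, Real.log ((max 4 (q i) : ℕ) : ℝ) ≤ ∏ i, (2 * Real.log (q i)) :=
          Finset.prod_le_prod (fun i _ => h0 i) fun i _ => hterm i
      _ = 2 ^ n * ∏ i, Real.log (q i) := by
          rw [Finset.prod_mul_distrib, Finset.prod_const, Finset.card_univ, Fintype.card_fin]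
  -- `log log max(4, max S) ≤ 3 X`
  have hll : Real.log (Real.log ((max 4 (S.sup id) : ℕ) : ℝ)) ≤ 3 * X := by
    set M : ℝ := ((max 4 (S.sup id) : ℕ) : ℝ) with hM
    have hM4 : (4 : ℝ) ≤ M := by rw [hM]; exact_mod_cast le_max_left _ _
    have hsup : ((S.sup id : ℕ) : ℝ) ≤ ∏ i, ((q i : ℕ) : ℝ) := by
      have h1 : S.sup id ≤ ∏ i, q i := by
        refine Finset.sup_le fun x hx => ?_
        obtain ⟨i, rfl⟩ := hSq x hx
        exact Finset.single_le_prod' (f := q) (fun j _ => (hq j).one_lt.le) (Finset.mem_univ i)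
      exact_mod_cast h1
    have hMle : M ≤ 4 * max 3 (∏ i, ((q i : ℕ) : ℝ)) := by
      have h3 : (1 : ℝ) ≤ max 3 (∏ i, ((q i : ℕ) : ℝ)) := le_trans (by norm_num) (le_max_left _ _)
      have hP : (∏ i, ((q i : ℕ) : ℝ)) ≤ max 3 (∏ i, ((q i : ℕ) : ℝ)) := le_max_right _ _
      rw [hM]; push_cast
      refine max_le (by linarith) ?_
      calc ((S.sup id : ℕ) : ℝ) ≤ ∏ i, ((q i : ℕ) : ℝ) := hsup
        _ ≤ max 3 (∏ i, ((q i : ℕ) : ℝ)) := hP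
        _ ≤ 4 * max 3 (∏ i, ((q i : ℕ) : ℝ)) := by linarith
    have hlogM : Real.log M ≤ Real.log 4 + X := by
      rw [hX, ← Real.log_mul (by norm_num) (by positivity)]
      exact Real.log_le_log (by linarith) hMle
    have hlog4 : Real.log 4 ≤ 2 := by
      have : Real.log 4 = 2 * Real.log 2 := by
        rw [show (4 : ℝ) = 2 ^ 2 by norm_num, Real.log_pow]; norm_num
      linarith [Real.log_two_lt_d9]
    have hlM0 : 0 < Real.log M := Real.log_pos (by linarith)
    calc Real.log (Real.log M) ≤ Real.log M - 1 := Real.log_le_sub_one_of_pos hlM0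
      _ ≤ Real.log 4 + X - 1 := by linarith
      _ ≤ 3 * X := by linarith
  -- assemble
  have hll0 : 0 ≤ Real.log (Real.log ((max 4 (S.sup id) : ℕ) : ℝ)) := by
    linarith [Summit.ABC.ABC.Theorems.PadicPrimesYuNinetyRung.loglog_max_four_ge (S.sup id)]
  have hPLm0 : 0 ≤ ∏ x ∈ S, Real.log ((max 4 x : ℕ) : ℝ) :=
    Finset.prod_nonneg fun x _ => Real.log_nonneg (by exact_mod_cast le_trans (by norm_num) (le_max_left 4 x))
  have hp0 : (0 : ℝ) ≤ (p : ℝ) ^ 2 := by positivity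
  have hmain : (c * n) ^ n * (p : ℝ) ^ 2 * Real.log B *
      Real.log (Real.log ((max 4 (S.sup id) : ℕ) : ℝ)) * ∏ x ∈ S, Real.log ((max 4 x : ℕ) : ℝ) ≤
      (C ^ n * (n : ℝ) ^ n) * (p : ℝ) ^ 2 * Real.log B * (3 * X) * (2 ^ n * PL) := by
    have hA0 : 0 ≤ C ^ n * (n : ℝ) ^ n := by positivity
    apply mul_le_mul _ hPLmax hPLm0 (by positivity)
    apply mul_le_mul _ hll hll0 (by positivity)
    exact mul_le_mul_of_nonneg_right (mul_le_mul_of_nonneg_right hcn hp0) hlogB0.le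
  have hshape : (C ^ n * (n : ℝ) ^ n) * (p : ℝ) ^ 2 * Real.log B * (3 * X) * (2 ^ n * PL) ≤
      3 * L ^ n * (n : ℝ) ^ ((1 : ℝ) * n) * (p : ℝ) ^ (2 : ℝ) * PL * Real.log B ^ (1 : ℕ) * X ^ (1 : ℕ) := by
    have hrpow : (n : ℝ) ^ ((1 : ℝ) * n) = (n : ℝ) ^ n := by rw [one_mul, Real.rpow_natCast]
    have hp2 : (p : ℝ) ^ (2 : ℝ) = (p : ℝ) ^ 2 := Real.rpow_two _
    rw [hrpow, hp2, pow_one, pow_one]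
    have h2C : (2 : ℝ) ^ n * C ^ n ≤ L ^ n := by
      rw [← mul_pow]; exact pow_le_pow_left₀ (by positivity) hLC n
    have hrest : 0 ≤ (n : ℝ) ^ n * (p : ℝ) ^ 2 * PL * Real.log B * X := by
      have := hX1; positivity
    calc (C ^ n * (n : ℝ) ^ n) * (p : ℝ) ^ 2 * Real.log B * (3 * X) * (2 ^ n * PL)
        = 3 * (2 ^ n * C ^ n) * ((n : ℝ) ^ n * (p : ℝ) ^ 2 * PL * Real.log B * X) := by ring
      _ ≤ 3 * L ^ n * ((n : ℝ) ^ n * (p : ℝ) ^ 2 * PL * Real.log B * X) := by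
          have := mul_le_mul_of_nonneg_right h2C hrest
          nlinarith
      _ = 3 * L ^ n * (n : ℝ) ^ n * (p : ℝ) ^ 2 * PL * Real.log B * X := by ring
  have hfin := (hlt.le.trans hmain).trans hshape
  rw [hBcast] at hfin
  exact hfin

end Summit.ABC.StewartYu

end
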